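import Summits.QuantumFields.BalabanUV.Beta.FP.HorizontalTailAssembly
import Summits.QuantumFields.BalabanUV.Beta.FP.HorizontalEndMeanNat

/-!
# `BalabanUV.Beta.FP.HorizontalTailAssemblyDefect` — road «FP» for binder row D1, row H′3-MEAN (owner ruling R-FP-17/R-FP-19,
# `HOME/b2b-balaban-beta-d1-p3/N7-PROOF.v3.1.md` §3): THE HORIZONTAL BOOKKEEPING WITH A DEFECTED (H1) — the bookkeeping term `D` of the
# kernel-level horizontal identity may carry a NONZERO second moment `ρ` (the REMAINDER LOOPS of the H′ route: Woodbury remainders `R^Q`, `R^g`,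
# coarse-determinant and border terms), and the MEAN END needs only `ρ(L^m)/m → 0`

HONEST DEPENDENCY (page 1, mandatory): continuum YM on T⁴ ⇐ BetaPertH ∧ nine spine estimates (0/9 proved); BetaPertH ⇐ (D1) ∧ (D4) ∧
CAP+tail; G-an2-4 gates asym, D1 and NE2/3/4.  HONEST FRAMING (cell contract, verbatim): «discharging `BetaPertH` makes Bałaban's UV
stability UNCONDITIONAL — a real constructive-QFT result; it is NOT the continuum limit and NOT the Clay problem.»  THIS MODULE is [folklore]
bookkeeping (a fifteen-line corollary of leaf-05-g8's `FP/HorizontalTailAssembly.abs_secondMoment_sub_window_le` by absorbing `D` into `T`, plus the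
squeeze that turns an `U + φ(m)`-defected `hbook` with `φ(m)/m → 0` into the MEAN END's hypothesis, composed BY NAME with leaf-05-g9's
`FP/HorizontalEndMeanNat`); no `def`, no `def … : Prop`, no cited fact, 0 sorry.  EVERY analytic input is a HYPOTHESIS with its supplier named; in
particular the size `|ρ_N| ≤ φ(N)` with `φ(L^m)/m → 0` of the remainder loops' second moment is road FP's rows IR-1…IR-6 ∕ (R6) (`LEAVES-FP.md`,
`IR3-DESIGN.md`) — NOT here.  NOT hbook-discharged, NOT hasym-discharged, NOT D1, NOT BetaPertH, NOT continuum, NOT Clay.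

ABSOLUTE RULE (cell charter, verbatim): «No internally-minted statement may enter as a cited fact. Every hypothesis is either kernel-proved in this
package or a verbatim quotation of a PUBLISHED theorem with page reference. The manuscript(s) under audit are NOT citable for their own disputed
steps — they are the thing under adjudication; programme-internal (2001/route/tribunal) claims are never citable.»

WHY (N7-PROOF.v3.1 §3, E-FP-5-1 ⟹ R-FP-17): under the v2 horizontal identity (H1) the bookkeeping term `D` was `M₂`-invisible (`HasSum (D·v_μv_ν) 0`);
under the H′ route the one-shot kernel `T_n` equals the transported `Π^{BF}` PLUS remainder loops whose windowed second moment `ρ_n` is NOT zero but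
`o(log n)` (MEAN grading, binding) ∕ `O(1)` (STRONG, stretch).  This file is the top node of that bookkeeping:
* §1 `secondMoment_add` (additivity of `B12Beta.secondMoment` under summability) and **`abs_secondMoment_sub_window_le_defect`**: the letters of
  `HorizontalTailAssembly.abs_secondMoment_sub_window_le` with `hD : HasSum (D·v_μ·v_ν) ρ` (ANY `ρ`) ⟹
  `|secondMoment T μ ν − Σ_{0<‖z‖∞≤N} K μ ν z·z_μ·z_ν| ≤ U₀ + U_T + (3·Cg + 67392·C) + |c₀| + |ρ|`;
* §2 the END glue: **`hbook_mean_of_defect`** (`|f m − g(L^m)| ≤ U + φ m` for `m ≥ 1` and `φ m / m → 0` ⟹ `(f m − g(L^m))/m → 0`), hence BY NAME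
  `hasym_mean_of_defect_stepBal` (+ leaf-05-g9's `hgerm` in slope form ⟹ the literal mean-law binder `hasym`) and `value_of_defect_step_stepBal`
  ((STEP) ⟹ `f 1 = stepBal N Lc` — «uniqueness does the identification»).
Provenance: road FP OWNER b2b-balaban-beta-d1-p3 gen 5 (prover-b2b-balaban-beta-d1-p3-g5-0), 2026-08-20, row H′3-MEAN ∕ H′3-ASM-0.
-/

noncomputable section

namespace Summit.QuantumFields.BalabanUV.Beta.FP.HorizontalTailAssemblyDefect

open Finset Filter Topology
open Literature.Probability.LatticeModels (annulus)
open Literature.MathematicalPhysics.QuantumFieldTheory.Balaban1983to89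
open Literature.MathematicalPhysics.QuantumFieldTheory.Balaban1983to89.Beta
open Literature.MathematicalPhysics.QuantumFieldTheory.Balaban1983to89.Beta.DyadicShell (Pt supNorm)
open B12Normalization (stepBal)
open Summit.QuantumFields.BalabanUV.Beta.FP.HorizontalTailAssembly (abs_secondMoment_sub_window_le)
open Summit.QuantumFields.BalabanUV.Beta.FP.HorizontalEndMeanNat (hasym_mean_of_horizontal_nat_stepBal value_of_horizontal_mean_step_nat_stepBal)

/-! ## §1 The assembly with a defected bookkeeping term -/

/-- [folklore] `B12Beta.secondMoment` is additive in the kernel under summability of the first summand's moment series and convergence of the second's. -/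
theorem secondMoment_add {T D : Fin 4 → Fin 4 → Pt → ℝ} {μ ν : Fin 4} {ρ : ℝ}
    (hT : Summable fun v : Pt => T μ ν v * (v μ : ℝ) * (v ν : ℝ))
    (hD : HasSum (fun v : Pt => D μ ν v * (v μ : ℝ) * (v ν : ℝ)) ρ) :
    B12Beta.secondMoment (fun a b v => T a b v + D a b v) μ ν = B12Beta.secondMoment T μ ν + ρ := by
  unfold B12Beta.secondMoment
  have h : ∀ v : Pt, (T μ ν v + D μ ν v) * (v μ : ℝ) * (v ν : ℝ)
      = T μ ν v * (v μ : ℝ) * (v ν : ℝ) + D μ ν v * (v μ : ℝ) * (v ν : ℝ) := fun v => by ring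
  simp_rw [h]
  exact (hT.hasSum.add hD).tsum_eq

/-- [folklore] **THE HORIZONTAL BOOKKEEPING WITH A DEFECTED (H1)**: the letters of `HorizontalTailAssembly.abs_secondMoment_sub_window_le` verbatim,
EXCEPT that the bookkeeping term `D` of the kernel-level identity `X = T + K + D` has second moment `ρ` (any real) instead of `0` ⟹
`|secondMoment T μ ν − Σ_{0<‖z‖∞≤N} K μ ν z·z_μ·z_ν| ≤ U₀ + U_T + (3·Cg + 67392·C) + |c₀| + |ρ|`.
(Proof: absorb `D` into `T` and apply the tree theorem with the zero bookkeeping term.) -/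
theorem abs_secondMoment_sub_window_le_defect {K T D : Fin 4 → Fin 4 → Pt → ℝ} {μ ν : Fin 4} {N : ℕ} (hN : 1 ≤ N)
    {X Xtr Xtl : Pt → ℝ} (hX : ∀ v, X v = Xtr v + Xtl v)
    (hH1 : ∀ v, X v = T μ ν v + K μ ν v + D μ ν v)
    (hT : Summable fun v : Pt => T μ ν v * (v μ : ℝ) * (v ν : ℝ))
    {ρ : ℝ} (hD : HasSum (fun v : Pt => D μ ν v * (v μ : ℝ) * (v ν : ℝ)) ρ)
    {E₀ U₀ : ℝ}
    (ha : HasSum (fun v : Pt => Xtr v * (v μ : ℝ) * (v ν : ℝ)) ((∑ z ∈ annulus 4 0 N, K μ ν z * (z μ : ℝ) * (z ν : ℝ)) + E₀))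
    (hE₀ : |E₀| ≤ U₀)
    {S U_T : ℝ}
    (hb : HasSum (fun v : Pt =>
      (Xtl v - (if 1 < supNorm v then (N : ℝ) ^ 6 * K μ ν ((N : ℤ) • v) else 0)) * (v μ : ℝ) * (v ν : ℝ)) S)
    (hS : |S| ≤ U_T)
    {C : ℝ} (hC : 0 ≤ C) (hK : ∀ z : Pt, |K μ ν z| ≤ C / ((supNorm z : ℝ) + 1) ^ 6)
    (hdK : ∀ (z : Pt) (i : Fin 4), |K μ ν (z + Pi.single i 1) - K μ ν z| ≤ C / ((supNorm z : ℝ) + 1) ^ 7)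
    {s c₀ Cg : ℝ}
    (hgerm : ∀ M : ℕ, 1 ≤ M → |∑ z ∈ annulus 4 0 M, K μ ν z * (z μ : ℝ) * (z ν : ℝ) - (s * Real.log M + c₀)| ≤ Cg) :
    |B12Beta.secondMoment T μ ν - ∑ z ∈ annulus 4 0 N, K μ ν z * (z μ : ℝ) * (z ν : ℝ)|
      ≤ U₀ + U_T + (3 * Cg + 67392 * C) + |c₀| + |ρ| := by
  -- absorb `D` into the step kernel
  have hH1' : ∀ v, X v = (fun a b v => T a b v + D a b v) μ ν v + K μ ν v + (fun (_ _ : Fin 4) (_ : Pt) => (0 : ℝ)) μ ν v := by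
    intro v; simp only [hH1 v]; ring
  have hT' : Summable fun v : Pt => (fun a b v => T a b v + D a b v) μ ν v * (v μ : ℝ) * (v ν : ℝ) := by
    have h : ∀ v : Pt, (T μ ν v + D μ ν v) * (v μ : ℝ) * (v ν : ℝ)
        = T μ ν v * (v μ : ℝ) * (v ν : ℝ) + D μ ν v * (v μ : ℝ) * (v ν : ℝ) := fun v => by ring
    simp only [h]
    exact hT.add hD.summable
  have hD' : HasSum (fun v : Pt => (fun (_ _ : Fin 4) (_ : Pt) => (0 : ℝ)) μ ν v * (v μ : ℝ) * (v ν : ℝ)) 0 := by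
    simp
  have key := abs_secondMoment_sub_window_le (T := fun a b v => T a b v + D a b v) (D := fun _ _ _ => (0 : ℝ))
    hN hX hH1' hT' hD' ha hE₀ hb hS hC hK hdK hgerm
  rw [secondMoment_add hT hD] at key
  -- `|a − g| ≤ |(a + ρ) − g| + |ρ|`
  have htri : |B12Beta.secondMoment T μ ν - ∑ z ∈ annulus 4 0 N, K μ ν z * (z μ : ℝ) * (z ν : ℝ)|
      ≤ |B12Beta.secondMoment T μ ν + ρ - ∑ z ∈ annulus 4 0 N, K μ ν z * (z μ : ℝ) * (z ν : ℝ)| + |ρ| := by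
    have e : B12Beta.secondMoment T μ ν - ∑ z ∈ annulus 4 0 N, K μ ν z * (z μ : ℝ) * (z ν : ℝ)
        = (B12Beta.secondMoment T μ ν + ρ - ∑ z ∈ annulus 4 0 N, K μ ν z * (z μ : ℝ) * (z ν : ℝ)) - ρ := by ring
    rw [e]
    exact abs_sub _ _
  linarith

/-! ## §2 The END glue: a defected `hbook` with `φ(m)/m → 0` feeds the MEAN END -/

/-- [folklore] **DEFECTED BOOKKEEPING ⟹ THE MEAN `hbook`**: if `|f m − g(L^m)| ≤ U + φ m` for `m ≥ 1` and `φ m / m → 0`, then `(f m − g(L^m))/m → 0`. -/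
theorem hbook_mean_of_defect {f g : ℕ → ℝ} {φ : ℕ → ℝ} {U : ℝ} {L : ℕ}
    (hbook : ∀ m : ℕ, 1 ≤ m → |f m - g (L ^ m)| ≤ U + φ m)
    (hφ : Tendsto (fun m : ℕ => φ m / (m : ℝ)) atTop (𝓝 0)) :
    Tendsto (fun m : ℕ => (f m - g (L ^ m)) / (m : ℝ)) atTop (𝓝 0) := by
  have hU : Tendsto (fun m : ℕ => U / (m : ℝ)) atTop (𝓝 0) := tendsto_const_div_atTop_nhds_zero_nat U
  have hsum : Tendsto (fun m : ℕ => U / (m : ℝ) + φ m / (m : ℝ)) atTop (𝓝 0) := by simpa using hU.add hφ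
  refine squeeze_zero_norm' ?_ hsum
  filter_upwards [eventually_ge_atTop 1] with m hm
  have hm0 : (0 : ℝ) < (m : ℝ) := by exact_mod_cast hm
  rw [Real.norm_eq_abs, abs_div, abs_of_pos hm0, ← add_div]
  exact div_le_div_of_nonneg_right (hbook m hm) hm0.le

/-- [folklore] **THE MEAN END FROM A DEFECTED `hbook`, in the cell's currency**: with the windowed germ letter in slope form
(`g M / log M → 11N²/(12π²)`, leaf-05-g9's `hgerm`), the conclusion is VERBATIM the mean-law binder
`hasym : Tendsto (fun m ↦ (f m − m·stepBal N Lc)/m) atTop (𝓝 0)` (`HorizontalEndMeanNat.hasym_mean_of_horizontal_nat_stepBal` BY NAME). -/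
theorem hasym_mean_of_defect_stepBal {f g : ℕ → ℝ} {φ : ℕ → ℝ} {U : ℝ} (N : ℝ) {Lc : ℕ}
    (hbook : ∀ m : ℕ, 1 ≤ m → |f m - g (Lc ^ m)| ≤ U + φ m)
    (hφ : Tendsto (fun m : ℕ => φ m / (m : ℝ)) atTop (𝓝 0))
    (hgerm : Tendsto (fun M : ℕ => g M / Real.log M) atTop (𝓝 (11 * N ^ 2 / (12 * Real.pi ^ 2)))) :
    Tendsto (fun m : ℕ => (f m - (m : ℝ) * stepBal N Lc) / (m : ℝ)) atTop (𝓝 0) :=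
  hasym_mean_of_horizontal_nat_stepBal N (hbook_mean_of_defect hbook hφ) hgerm

/-- [folklore] **… AND WITH (STEP), THE VALUE**: a defected `hbook` + `φ m / m → 0` + the slope germ + the step law `f (m+1) = f m + f 1` (`m ≥ 1`) ⟹
`f 1 = stepBal N Lc` — «uniqueness does the identification» (`HorizontalEndMeanNat.value_of_horizontal_mean_step_nat_stepBal` BY NAME). -/
theorem value_of_defect_step_stepBal {f g : ℕ → ℝ} {φ : ℕ → ℝ} {U : ℝ} (N : ℝ) {Lc : ℕ}
    (hbook : ∀ m : ℕ, 1 ≤ m → |f m - g (Lc ^ m)| ≤ U + φ m)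
    (hφ : Tendsto (fun m : ℕ => φ m / (m : ℝ)) atTop (𝓝 0))
    (hgerm : Tendsto (fun M : ℕ => g M / Real.log M) atTop (𝓝 (11 * N ^ 2 / (12 * Real.pi ^ 2))))
    (hstep : ∀ m : ℕ, 1 ≤ m → f (m + 1) = f m + f 1) :
    f 1 = stepBal N Lc :=
  value_of_horizontal_mean_step_nat_stepBal N (hbook_mean_of_defect hbook hφ) hgerm hstep

/-- [folklore] The MEAN grading's defect letter in the form the remainder rows deliver it: `|ρ m| ≤ φ m` with `φ m / m → 0` ⟹ `ρ m / m → 0`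
(so a bound `o(m)` = `o(log L^m)` on the remainder loops' windowed second moment at blocking `L^m` is exactly what §2 consumes). -/
theorem tendsto_div_of_abs_le {ρ φ : ℕ → ℝ} (hρ : ∀ m : ℕ, 1 ≤ m → |ρ m| ≤ φ m)
    (hφ : Tendsto (fun m : ℕ => φ m / (m : ℝ)) atTop (𝓝 0)) :
    Tendsto (fun m : ℕ => ρ m / (m : ℝ)) atTop (𝓝 0) := by
  refine squeeze_zero_norm' ?_ hφ
  filter_upwards [eventually_ge_atTop 1] with m hm
  have hm0 : (0 : ℝ) < (m : ℝ) := by exact_mod_cast hm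
  rw [Real.norm_eq_abs, abs_div, abs_of_pos hm0]
  exact div_le_div_of_nonneg_right (hρ m hm) hm0.le

end Summit.QuantumFields.BalabanUV.Beta.FP.HorizontalTailAssemblyDefect

end
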